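import Summits.QuantumFields.YangMills.Theorems.BalabanUVNodesN12AtRecord13TermPinnedCubes
import Literature.MathematicalPhysics.QuantumFieldTheory.Balaban1983to89.B15Claim189LambdaPin

/-!
# BalabanUVNodes ∕ N12 AT THE `Λ`-PINNED TERM-PINNED STAGE-13 LAYER ON THE LIVE LINE — the [IV] leaf at `WOfRecord₁₃ (Θ.liveRepin₁₃) λᴧ P` with the (1.100) data pinned to Record 13's
# 𝐑-step and the (1.89) letters pinned to the term's situation WITH `Λ := (Ω^{∼4}_{k₀+1})ᶜ ∩ Z` OF (1.73) (dag-n12-e module 16 `Sit189.pinLambda` over the enlargement of record `enlD`), the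
# distance letter, `Z″` and the (1.88) cube data pinned: NO located-geometry binder at all (`hZk`, `hbox`, `hdist`, `hgeom` ALL THEOREMS), NO `Provisos₁₃`, NO (1.89) display, pin equation
# `rfl`, mass in the live form — generic and at the plan's `L`-keyed witness `θ₁₅ᶜ = theta13OfThm1C`
# (sequel of `…N12AtRecord13TermPinnedCubes` (12F); Track A, DAG node N12 = [B15, Balaban1989LargeFieldI] CMP **122** (1989) 175–202; cluster K1⁗ `StabilityBAtRecordR13Sep` =
# stmt-QuantumFields-20290 (REV 18; the rows below are θ-level, read NO proviso and serve ‴ and ⁗ alike); seat `pub-ymgap-dag-n12-d` g8 (R134 s2; HANDOFF trigger t23), 2026-08-27;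
# count-neutral, NOT a discharge)

HONEST FRAMING.  Count-neutral kernel BOOKKEEPING BY NAME: 12E's ★★ `b15Leaf_WOfRecord₁₃_liveRepin₁₃_of_massLive_of_hasResiduals` (N12's row at the live re-pin of a `Θ` carrying K0b's
residuals ⟸ pin equation + live-mass + Prop. 1 + (1.80) + (1.89); NO `Provisos₁₃`) AT dag-n12-e g6's LETTER OF RECORD `ResidW.pinD189ΛH` (module 16 v1.1 §9, p506979) with the `h189` slot
SUPPLIED BY NAME by his `h189_pinD189ΛH_of_h180_of_flow` ∕ `h189_pinD189ΛH₁₃_of_h180_of_inInterval` (= ★★★ `claim189_sitOfHist_Λ_of_flow` ∕ §7 at `rfl`) — (1.89) at the term's situation pinned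
in the order `pinLambda → pinDistAt → pinZpp → pinCubes` over `enlD`, with «We have j = k» (module 13), the (1.88) cover (module 15), `dist ≥ 0`
(module 15), the enlargement's inflationarity AND the shell bound read as used, `4M ≤ dist(p, Λ)` (module 16's lattice theorem `hcollar_sitOfHist_pinLambda`), all THEOREMS.  Nothing of
Bałaban's is asserted or proved here; NO estimate.  What stays DISPLAYED per run is print's: «every LIVE pre-𝐑 term at level `kSel P + 1` has positive mass» (NODE 00), Proposition 1
(1.78) at `λ.LF P`, the levels `1 < (log g_{k′}⁻²)^r` (⇒ `N₀ ≥ 2`), `N₀ ≤ N P`, `N₀ ≤ k′`, the situation's residual numbers and print's two p. 200 conditions, `0 < σ.sh`, `0 < M`, the flow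
inputs `hε0 ∕ hε1 ∕ hflow` along the ₁₃ history, ONE STEP of monotone couplings `0 < g_{k′+1−N₀} ≤ g_{k′+2−N₀} ≤ 1` (module 16's `N₀`-equation input), the side condition **`Λ ≠ ∅`**
(a non-trivial 𝐑-step — module 16 §8 shows it load-bearing), the four ℍ-leaves (1.91) ∕ (1.95) ∕ (1.91)-type ∕ (1.97) and (1.80) at the pinned letters ([B11]-at-objects, N07).
N12 is NOT discharged; no node is; counts unmoved (Track A discharged 5∕28).  ONE finite four-torus programme at fixed `ε = L^{-K}` — nothing continuum ∕ ℝ⁴ ∕ OS ∕ mass gap ∕ Clay.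

WHAT THIS FILE GIVES (count-neutral):
* §1 generic `Θ` carrying K0b's residuals, run with `kSel P < K`: ★★ `b15Leaf_WOfRecord₁₃_pinAllΛ_N0_liveRepin₁₃_of_massLive_of_hasResiduals_of_flow` — 12F's ★★ geometry row with its LAST
  located input `hgeom` (and the enlargement letter `enl ∕ henl`) GONE: the layer is dag-n12-e's LETTER OF RECORD `λᴧ := (λ.pinRPrime₁₃ θL).pinD189ΛH θL.ν θL.A₁ θL.τ9.M (gOfRecord₁₃ θL) σ s N p₁`
  (module 16 v1.1 §9: `pinD189TH` at the full pin stack `σᴧ P := ((((σ P).pinLambda (s P) N₀ enlD).pinDistAt k′).pinZpp (s P) N₀ (N P) enlD).pinCubes ((…).OmTᶜ ∩ Ω_{k′−N}(s P))`,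
  `N₀ = N0OfSeq L r (g P) k′ = N0OfRecord₁₃ θL P k′` by `rfl`), and the `h189` slot is SUPPLIED BY NAME by his `h189_pinD189ΛH_of_h180_of_flow` — window-free; new displayed inputs vs 12F:
  `0 < M`, the coupling step `hgpos ∕ hgstep ∕ hgle`, `Λ ≠ ∅`; and ★★ `…_of_inInterval` — the same in the run's (2.7)-small window `]0, θL.γ]` (module 16 §7: flow inputs, coupling step and print's first
  condition from the window + `BetaUpperH` + one threshold `hwin`; contentful at a small-`γ` Stage-13 parameter, NOT at `θ₁₅ᶜ`).
* §2 at the plan's witness `θ₁₅ᶜ`: `new189_pinAllTHΛ_theta13OfThm1C_one_zero` (non-vacuity at `(1, 0)`, admissibility ⟸ the five witness signs) and ★★★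
  `b15Leaf_WOfRecord₁₃_pinAllΛ_N0_theta13OfThm1C_of_massLive_of_flow` — N12's MOST-PINNED ROW OF RECORD: ZERO K0-side hypotheses, NO (1.89) display, NO located-geometry binder; ITS
  HYPOTHESIS LIST IS THE KERNEL's CENSUS OF WHAT N12 COSTS PER RUN (below the torus) AT THE PLAN's WITNESS, now about objects of record only: live-mass at level `kSel P + 1` (NODE 00 measure
  theory); Prop. 1 at `λ.LF P` (closer's letter; dag-n12-c's `prop1Printed_lfVarOn_std_su2_*` at `N = 2`); the levels; the situation's residual numbers `0 ≤ β ≤ ¼`, `2 ≤ L₀`, `L₀² ≤ L`,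
  `0 ≤ O(1)B₃B₅`, `0 ≤ δ`, `0 < sh`, print's two p. 200 conditions (`0 < M` DISCHARGED: `M` of record is `1` at `θ₁₅ᶜ`, `rfl`); the flow inputs ((2.8a) is NOT a theorem at `γ = ½` — a genuine run
  restriction at `θ₁₅ᶜ`); the coupling step;
  `Λ ≠ ∅`; the four ℍ-leaves + (1.80); and on runs with `K ≤ kSel P` the leaf itself (12E).  The window form (module 16 §7 `claim189_sitOfHist₁₃_Λ_of_inInterval`, couplings step and flow
  inputs from `]0, θ.γ]` + `BetaUpperH` + (2.7)-smallness) is NOT restated at `θ₁₅ᶜ`: `SmallnessFor θ₁₅ᶜ.γ …` is unsatisfiable at `γ = ½` (dag-n12-e g2 ∕ this seat g5), so it would be vacuous there.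

Sources: [Balaban1989LargeFieldI] (0.2)–(0.6) p.176, p.176 ll.14–16, p.177 (i)–(ii), (1.10)–(1.11) p.179, (1.73) p.192, Prop. 1 (1.78) p.194, (1.80) p.195, (1.88)–(1.90) pp.197–198,
pp.199–201; [Balaban1988Convergent] (2.1) p.254, (2.4)–(2.8) pp.255–256, (2.17) p.257, (3.16) p.268, (3.22)–(3.25) pp.269–270; [Balaban1987RG1] (0.20) p.256, §1 p.264 (the coupling
step's printed home); [Balaban1985Variational] Thm 1 p.279 (witness letters only).
-/

noncomputable section

open MeasureTheory
open scoped Matrix.Norms.L2Operator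

namespace Summit.QuantumFields.YangMills.BalabanUVNodes.N12AtRecord13TermPinnedLambda

open Literature.MathematicalPhysics.QuantumFieldTheory.Balaban1983to89
open Literature.MathematicalPhysics.QuantumFieldTheory.Balaban1983to89.T4Continuum (T4Family)
open Literature.MathematicalPhysics.QuantumFieldTheory.Balaban1983to89.DagBinding (PrintedCarriers15 B15Leaf)
open Literature.MathematicalPhysics.QuantumFieldTheory.Balaban1983to89.Node00
open B15Claim189Assembly (Setting189 new189 chiPP dom half)
open B15 (Prop1Printed Ineq180)
open B15.BasicStep (Claim189)
open B15.PrelimIntegrations (Ineq191 Ineq195)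
open B15Chi124DetSets (E124)
open B15DeterminingSets (MSField)
open B14DomainGeom (Pt)
open B8Eq17ClassAkV1 (plaqsOf)
open GaugeGroup (dist1)
open GaugeField (plaqHol)
open B15Claim189PrintedConditions (omegaOfChain)
open B15Claim189PinsOfHistory (sitOfHist N0OfRecord₁₃ D189OfHist)
open B15Claim189LambdaPin (enlD h189_pinD189ΛH_of_h180_of_flow h189_pinD189ΛH₁₃_of_h180_of_inInterval)
open FlowStep (prefixOf BetaUpperH)
open B14FlowStep (SmallnessFor)
open Summit.QuantumFields.YangMills.BalabanUVNodes.N12AtRecord13OfResiduals (b15Leaf_WOfRecord₁₃_liveRepin₁₃_of_massLive_of_hasResiduals)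
open Summit.QuantumFields.YangMills.BalabanUVNodes.N12AtRecord13TermPinned (new189_pinAllTH_liveRepin₁₃_one_zero)

variable {N : ℕ} [NeZero N] {F : T4Family}

/-! ## §1 GENERIC `Θ` CARRYING K0b's RESIDUALS — the `Λ`-pinned term-pinned row at `θL := Θ.liveRepin₁₃`, window-free, NO located-geometry binder -/

section Leaf
variable (Θ : Stage13Params F N) (lam : ResidW F N) (σ : ∀ P : B12.RunParams, Sit189 F N P.K)
  (s : ∀ P : B12.RunParams, SeqOfRecord F Θ.ν Θ.τ9.M (gOfRecord₁₃ F N (Θ.liveRepin₁₃ F N) P) P.K (lam.kSel P + 1)) (Nm : B12.RunParams → ℕ) (p₁ : ℕ)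

/-- **★★ THE [IV] LEAF AT `WOfRecord₁₃ θL λᴧ P` (`θL := Θ.liveRepin₁₃`, `Θ` CARRYING K0b's RESIDUALS) FOR A RUN WITH `kSel P < K` — WINDOW-FREE, NO `Provisos₁₃`, NO (1.89) DISPLAY, NO
LOCATED-GEOMETRY BINDER** (12F's `…pinAllGeom_N0…` row with `hgeom`, `enl`, `henl` GONE): 12E's `b15Leaf_WOfRecord₁₃_liveRepin₁₃_of_massLive_of_hasResiduals` at the `Λ`-pinned term-pinned layer
`λᴧ = (λ.pinRPrime₁₃ θL).pinD189ΛH …` (pin equation `rfl`) with the `h189` slot SUPPLIED BY NAME by dag-n12-e module 16 v1.1's `h189_pinD189ΛH_of_h180_of_flow`.  Stated with a defining equation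
`hD` for the letters (instantiate `rfl`).  DISPLAYED:
positive mass of the LIVE pre-𝐑 terms at level `kSel P + 1`, Prop. 1 at `λ.LF P`, `1 < (log g_{k′}⁻²)^r`, `N₀ ≤ N P`, `N₀ ≤ k′`, the residual numerics and signs, print's two p. 200 conditions
(`hN₀ hMl`), `0 < σ.sh`, `0 < M`, the flow inputs along the ₁₃ history (`hε0 hε1 hflow`), ONE STEP of monotone couplings (`hgpos hgstep hgle`), `Λ ≠ ∅` (`hΛ`), the four ℍ-leaves (`L91h L95 L91 L97`)
and (1.80) (`L80`). [cite: Balaban1989LargeFieldI, (0.2)–(0.6) p.176, p.176 ll.14–16, (1.73) p.192, Prop. 1 (1.78) p.194, (1.80) p.195, (1.10)–(1.11) p.179, (1.88)–(1.90) pp.197–198, pp.199–201; Balaban1988Convergent, (2.1) p.254, (2.5)–(2.8) pp.255–256, (2.17) p.257, (3.16) p.268, (3.22)–(3.25) pp.269–270; Balaban1987RG1, (0.20) p.256] -/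
theorem b15Leaf_WOfRecord₁₃_pinAllΛ_N0_liveRepin₁₃_of_massLive_of_hasResiduals_of_flow (hres : Θ.HasResidualsOfRecord F N)
    {P : B12.RunParams} (hK : lam.kSel P < P.K) (hsh : 0 < (σ P).sh) (hM : 0 < Θ.τ9.M)
    {D : Setting189 (F.P P.K) (SU N) (MSField (F.P P.K) (SU N) × ((j : ℕ) → VecField (F.P P.K) j (EuclideanSpace ℝ (Fin (N ^ 2 - 1))))) (Pt (F.P P.K).d)}
    (hD : D = ((lam.pinRPrime₁₃ (Θ.liveRepin₁₃ F N)).pinD189ΛH (Θ.liveRepin₁₃ F N).ν (Θ.liveRepin₁₃ F N).A₁ (Θ.liveRepin₁₃ F N).τ9.M (gOfRecord₁₃ F N (Θ.liveRepin₁₃ F N)) σ s Nm p₁).D189 P)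
    (hmassLive : ∀ a, LiveSeq F N Θ.ν Θ.τ9 P (gOfRecord₁₃ F N (Θ.liveRepin₁₃ F N) P) (lam.kSel P + 1)
        (slotsTOfRecord F N Θ.ν Θ.τ9 (EOfRecord₁₃ F N (Θ.liveRepin₁₃ F N)) (wOfRecord₉ F N (Θ.liveRepin₁₃ F N).toStage9Params)
          (Θ.liveRepin₁₃ F N).ppSel P (gOfRecord₁₃ F N (Θ.liveRepin₁₃ F N) P) (lam.kSel P + 1)) a →
      0 < ∫ V, rterm (reprTOfRecord₁₃ F N (Θ.liveRepin₁₃ F N) P (lam.kSel P)) a V ∂(fieldMeasure (F.P P.K) (lam.kSel P + 1) (SU N)))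
    (hP1 : Prop1Printed (lam.LF P))
    (hlog : 1 < (Real.log (gOfRecord₁₃ F N (Θ.liveRepin₁₃ F N) P (lam.kSel P + 1) ^ 2)⁻¹) ^ Θ.ν.r)
    (hNN : N0OfRecord₁₃ (Θ.liveRepin₁₃ F N) P (lam.kSel P + 1) ≤ Nm P) (hNk : N0OfRecord₁₃ (Θ.liveRepin₁₃ F N) P (lam.kSel P + 1) ≤ lam.kSel P + 1)
    (hβ0 : 0 ≤ (σ P).β) (hβ : (σ P).β ≤ 1 / 4) (hL₀ : 2 ≤ (σ P).L₀) (hL₀L : (σ P).L₀ ^ 2 ≤ ((F.P P.K).L : ℝ))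
    (hB : 0 ≤ (σ P).O1 * (σ P).B₃ * (σ P).B₅) (hδ : 0 ≤ (σ P).δ)
    (hN₀ : (2 + (121 / 120) ^ 2 * ((σ P).O1 * (σ P).B₃ * (σ P).B₅ * (Θ.τ9.M : ℝ) ^ 5)) *
      ((((σ P).L₀ ^ 2) ^ (N0OfRecord₁₃ (Θ.liveRepin₁₃ F N) P (lam.kSel P + 1) - 1))⁻¹) ≤ 1 / 4)
    (hMl : (121 / 120) ^ 2 * ((σ P).O1 * (σ P).B₃ * (σ P).B₅ * (Θ.τ9.M : ℝ) ^ 5) * Real.exp (-(4 * (σ P).δ * (Θ.τ9.M : ℝ))) ≤ 1 / 12)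
    (hε0 : ∀ i, lam.kSel P + 1 - Nm P ≤ i → i ≤ lam.kSel P + 1 → 0 ≤ epsOfRecord Θ.ν (gOfRecord₁₃ F N (Θ.liveRepin₁₃ F N) P) i)
    (hε1 : ∀ i, lam.kSel P + 1 - Nm P ≤ i → i ≤ lam.kSel P + 1 → epsOfRecord Θ.ν (gOfRecord₁₃ F N (Θ.liveRepin₁₃ F N) P) i ≤ 1 / 10)
    {β₀ : ℝ} (hβ₀0 : 0 ≤ β₀) (hβ₀ : β₀ ≤ 1 / 2)
    (hflow : ∀ j, lam.kSel P + 1 - Nm P ≤ j → j < lam.kSel P + 1 → epsOfRecord Θ.ν (gOfRecord₁₃ F N (Θ.liveRepin₁₃ F N) P) (lam.kSel P + 1)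
      ≤ (1 + β₀) * Real.sqrt ((lam.kSel P + 1 - j : ℕ) : ℝ) * epsOfRecord Θ.ν (gOfRecord₁₃ F N (Θ.liveRepin₁₃ F N) P) j)
    -- the `N₀`-equation's one step of monotone couplings, and `Λ ≠ ∅` (a non-trivial 𝐑-step)
    (hgpos : 0 < (gOfRecord₁₃ F N (Θ.liveRepin₁₃ F N) P) (lam.kSel P + 1 + 1 - (N0OfRecord₁₃ (Θ.liveRepin₁₃ F N) P (lam.kSel P + 1))))
    (hgstep : (gOfRecord₁₃ F N (Θ.liveRepin₁₃ F N) P) (lam.kSel P + 1 + 1 - (N0OfRecord₁₃ (Θ.liveRepin₁₃ F N) P (lam.kSel P + 1))) ≤ (gOfRecord₁₃ F N (Θ.liveRepin₁₃ F N) P) (lam.kSel P + 1 + 2 - (N0OfRecord₁₃ (Θ.liveRepin₁₃ F N) P (lam.kSel P + 1))))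
    (hgle : (gOfRecord₁₃ F N (Θ.liveRepin₁₃ F N) P) (lam.kSel P + 1 + 2 - (N0OfRecord₁₃ (Θ.liveRepin₁₃ F N) P (lam.kSel P + 1))) ≤ 1)
    (hΛ : (((enlD F Θ.ν Θ.τ9.M P (gOfRecord₁₃ F N (Θ.liveRepin₁₃ F N) P)) 4 (lam.kSel P + 1 + 1 - (N0OfRecord₁₃ (Θ.liveRepin₁₃ F N) P (lam.kSel P + 1)))
        (omegaOfChain (s P) (lam.kSel P + 1 + 1 - (N0OfRecord₁₃ (Θ.liveRepin₁₃ F N) P (lam.kSel P + 1)))))ᶜ ∩ (σ P).Z).Nonempty)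
    (L91h : ∀ U, new189 D U → ∀ p ∈ plaqsOf (half D),
      Ineq191 (dist1 (plaqHol (D.Upp U) p)) (D.devV'' U p) D.α ((D.L ^ D.h)⁻¹) (D.ε D.h) (E124 D.ε D.L D.η D.k D.h))
    (L95 : ∀ U, new189 D U → ∀ p ∈ plaqsOf (half D),
      Ineq195 (D.devV'' U p) (dist1 (plaqHol (D.Uhalf U (D.boxOf p)) p)) D.α ((D.L ^ D.h)⁻¹) (D.ε D.h) (E124 D.ε D.L D.η D.k D.h))
    (L91 : ∀ U, new189 D U → ∀ j, D.h ≤ j → j ≤ D.k → ∀ p ∈ plaqsOf (dom D j),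
      Ineq191 (dist1 (plaqHol (D.Upp U) p)) (D.dev97 U p) D.α ((D.L ^ j)⁻¹) (D.ε j) (E124 D.ε D.L D.η D.k j))
    (L97 : ∀ U, new189 D U → ∀ j, D.h ≤ j → j ≤ D.k → ∀ p ∈ plaqsOf (dom D j),
      Ineq191 (D.dev97 U p) (D.dev0 U p) D.α ((D.L ^ j)⁻¹) (D.ε j) (E124 D.ε D.L D.η D.k j))
    (L80 : ∀ U, new189 D U → ∀ j, D.h ≤ j → j ≤ D.k → ∀ p ∈ plaqsOf (dom D j),
      Ineq180 (D.dev0 U p) (D.ε D.k) D.η D.B₃ D.B₅ D.M D.δ (D.dist p) D.O1) :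
    B15Leaf (WOfRecord₁₃ F N (Θ.liveRepin₁₃ F N)
      ((lam.pinRPrime₁₃ (Θ.liveRepin₁₃ F N)).pinD189ΛH (Θ.liveRepin₁₃ F N).ν (Θ.liveRepin₁₃ F N).A₁ (Θ.liveRepin₁₃ F N).τ9.M (gOfRecord₁₃ F N (Θ.liveRepin₁₃ F N)) σ s Nm p₁) P) := by
  subst hD
  exact b15Leaf_WOfRecord₁₃_liveRepin₁₃_of_massLive_of_hasResiduals Θ _ hres hK rfl hmassLive hP1 (fun U hU i hi hik q hq => L80 U hU i hi hik q hq)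
    (h189_pinD189ΛH_of_h180_of_flow P hsh hM hlog hNN hNk hβ0 hβ hL₀ hL₀L hB hδ hN₀ hMl hε0 hε1 hβ₀0 hβ₀ hflow hgpos hgstep hgle hΛ L91h L95 L91 L97 L80)


/-- **★★ THE SAME IN THE RUN's (2.7)-SMALL WINDOW** (module 16 §7 `claim189_sitOfHist₁₃_Λ_of_inInterval` at `θ := Θ.liveRepin₁₃`): the level input `2 ≤ N₀` from `r ≥ 1`, print's first p. 200
condition from ONE threshold on `g_{k′}` (`hwin`) and `β₁₃ ≥ 0` along the history, the flow inputs AND the coupling step from the window `]0, θL.γ]` up to `k′ = kSel P + 1` with the box bound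
`BetaUpperH β′ θL.γ (betaOfRecord₁₃ θL)`; NO located-geometry binder.  HONEST REACH: NOT instantiated at the plan's witness `θ₁₅ᶜ` (`SmallnessFor θ₁₅ᶜ.γ …` is unsatisfiable at `γ = ½` — the
window-free §1∕§2 rows serve there); contentful at a Stage-13 parameter with a small window. [cite: Balaban1989LargeFieldI, (0.2)–(0.6) p.176, (1.73) p.192, Prop. 1 (1.78) p.194, (1.80) p.195, (1.89) p.198, pp.199–201; Balaban1988Convergent, (2.1) p.254, (2.4)–(2.8) pp.255–256; Balaban1987RG1, (0.20) p.256, §1 p.264] -/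
theorem b15Leaf_WOfRecord₁₃_pinAllΛ_N0_liveRepin₁₃_of_massLive_of_hasResiduals_of_inInterval (hres : Θ.HasResidualsOfRecord F N)
    {P : B12.RunParams} (hK : lam.kSel P < P.K) (hsh : 0 < (σ P).sh) (hM : 0 < Θ.τ9.M)
    {D : Setting189 (F.P P.K) (SU N) (MSField (F.P P.K) (SU N) × ((j : ℕ) → VecField (F.P P.K) j (EuclideanSpace ℝ (Fin (N ^ 2 - 1))))) (Pt (F.P P.K).d)}
    (hD : D = ((lam.pinRPrime₁₃ (Θ.liveRepin₁₃ F N)).pinD189ΛH (Θ.liveRepin₁₃ F N).ν (Θ.liveRepin₁₃ F N).A₁ (Θ.liveRepin₁₃ F N).τ9.M (gOfRecord₁₃ F N (Θ.liveRepin₁₃ F N)) σ s Nm p₁).D189 P)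
    (hmassLive : ∀ a, LiveSeq F N Θ.ν Θ.τ9 P (gOfRecord₁₃ F N (Θ.liveRepin₁₃ F N) P) (lam.kSel P + 1)
        (slotsTOfRecord F N Θ.ν Θ.τ9 (EOfRecord₁₃ F N (Θ.liveRepin₁₃ F N)) (wOfRecord₉ F N (Θ.liveRepin₁₃ F N).toStage9Params)
          (Θ.liveRepin₁₃ F N).ppSel P (gOfRecord₁₃ F N (Θ.liveRepin₁₃ F N) P) (lam.kSel P + 1)) a →
      0 < ∫ V, rterm (reprTOfRecord₁₃ F N (Θ.liveRepin₁₃ F N) P (lam.kSel P)) a V ∂(fieldMeasure (F.P P.K) (lam.kSel P + 1) (SU N)))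
    (hP1 : Prop1Printed (lam.LF P))
    (hr : 1 ≤ Θ.ν.r) (hNN : (N0OfRecord₁₃ (Θ.liveRepin₁₃ F N) P (lam.kSel P + 1)) ≤ Nm P) (hNk : (N0OfRecord₁₃ (Θ.liveRepin₁₃ F N) P (lam.kSel P + 1)) ≤ lam.kSel P + 1)
    (hβ0 : 0 ≤ (σ P).β) (hβ : (σ P).β ≤ 1 / 4) (hL₀ : 2 ≤ (σ P).L₀) (hL₀L : (σ P).L₀ ^ 2 ≤ ((F.P P.K).L : ℝ))
    (hB : 0 ≤ (σ P).O1 * (σ P).B₃ * (σ P).B₅) (hδ : 0 ≤ (σ P).δ)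
    (hwin : 4 * (2 + (121 / 120) ^ 2 * ((σ P).O1 * (σ P).B₃ * (σ P).B₅ * (Θ.τ9.M : ℝ) ^ 5))
      ≤ ((Real.log ((gOfRecord₁₃ F N (Θ.liveRepin₁₃ F N) P) (lam.kSel P + 1) ^ 2)⁻¹) ^ Θ.ν.r) ^ (Real.log ((σ P).L₀ ^ 2) / Real.log ((F.P P.K).L : ℝ)))
    (hβhist : ∀ j, j < lam.kSel P + 1 → 0 ≤ betaOfRecord₁₃ F N (Θ.liveRepin₁₃ F N) j (prefixOf (gOfRecord₁₃ F N (Θ.liveRepin₁₃ F N) P) j))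
    (hMl : (121 / 120) ^ 2 * ((σ P).O1 * (σ P).B₃ * (σ P).B₅ * (Θ.τ9.M : ℝ) ^ 5) * Real.exp (-(4 * (σ P).δ * (Θ.τ9.M : ℝ))) ≤ 1 / 12)
    (hA₀ : 0 ≤ Θ.ν.A₀) {β' β₀ : ℝ} {L : ℕ} (S : SmallnessFor (Θ.liveRepin₁₃ F N).γ β' β₀ L Θ.ν.p₀) (hβ₀ : β₀ ≤ 1 / 2)
    (hε10 : (Θ.liveRepin₁₃ F N).γ * p0Profile Θ.ν.A₀ Θ.ν.p₀ (Θ.liveRepin₁₃ F N).γ ≤ 1 / 10)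
    (hI : Step.InInterval (Θ.liveRepin₁₃ F N).γ (lam.kSel P + 1) (gOfRecord₁₃ F N (Θ.liveRepin₁₃ F N) P)) (hup : BetaUpperH β' (Θ.liveRepin₁₃ F N).γ (betaOfRecord₁₃ F N (Θ.liveRepin₁₃ F N)))
    (hΛ : (((enlD F Θ.ν Θ.τ9.M P (gOfRecord₁₃ F N (Θ.liveRepin₁₃ F N) P)) 4 (lam.kSel P + 1 + 1 - (N0OfRecord₁₃ (Θ.liveRepin₁₃ F N) P (lam.kSel P + 1)))
        (omegaOfChain (s P) (lam.kSel P + 1 + 1 - (N0OfRecord₁₃ (Θ.liveRepin₁₃ F N) P (lam.kSel P + 1)))))ᶜ ∩ (σ P).Z).Nonempty)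
    (L91h : ∀ U, new189 D U → ∀ p ∈ plaqsOf (half D),
      Ineq191 (dist1 (plaqHol (D.Upp U) p)) (D.devV'' U p) D.α ((D.L ^ D.h)⁻¹) (D.ε D.h) (E124 D.ε D.L D.η D.k D.h))
    (L95 : ∀ U, new189 D U → ∀ p ∈ plaqsOf (half D),
      Ineq195 (D.devV'' U p) (dist1 (plaqHol (D.Uhalf U (D.boxOf p)) p)) D.α ((D.L ^ D.h)⁻¹) (D.ε D.h) (E124 D.ε D.L D.η D.k D.h))
    (L91 : ∀ U, new189 D U → ∀ j, D.h ≤ j → j ≤ D.k → ∀ p ∈ plaqsOf (dom D j),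
      Ineq191 (dist1 (plaqHol (D.Upp U) p)) (D.dev97 U p) D.α ((D.L ^ j)⁻¹) (D.ε j) (E124 D.ε D.L D.η D.k j))
    (L97 : ∀ U, new189 D U → ∀ j, D.h ≤ j → j ≤ D.k → ∀ p ∈ plaqsOf (dom D j),
      Ineq191 (D.dev97 U p) (D.dev0 U p) D.α ((D.L ^ j)⁻¹) (D.ε j) (E124 D.ε D.L D.η D.k j))
    (L80 : ∀ U, new189 D U → ∀ j, D.h ≤ j → j ≤ D.k → ∀ p ∈ plaqsOf (dom D j),
      Ineq180 (D.dev0 U p) (D.ε D.k) D.η D.B₃ D.B₅ D.M D.δ (D.dist p) D.O1) :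
    B15Leaf (WOfRecord₁₃ F N (Θ.liveRepin₁₃ F N)
      ((lam.pinRPrime₁₃ (Θ.liveRepin₁₃ F N)).pinD189ΛH (Θ.liveRepin₁₃ F N).ν (Θ.liveRepin₁₃ F N).A₁ (Θ.liveRepin₁₃ F N).τ9.M (gOfRecord₁₃ F N (Θ.liveRepin₁₃ F N)) σ s Nm p₁) P) := by
  subst hD
  exact b15Leaf_WOfRecord₁₃_liveRepin₁₃_of_massLive_of_hasResiduals Θ _ hres hK rfl hmassLive hP1 (fun U hU i hi hik q hq => L80 U hU i hi hik q hq)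
    (h189_pinD189ΛH₁₃_of_h180_of_inInterval (θ := Θ.liveRepin₁₃ F N) P hsh hM hr hNN hNk hβ0 hβ hL₀ hL₀L hB hδ hwin hβhist hMl hA₀ S hβ₀ hε10 hI hup hΛ
      L91h L95 L91 L97 L80)

end Leaf

/-! ## §2 AT THE PLAN's `L`-KEYED WITNESS `θ₁₅ᶜ = theta13OfThm1C F N ε₀ ε₂₉ B₃ a₀ a₁` (K0a FILE 11a; K0b's residuals of record by `hasResidualsOfRecord_theta13OfNumerics`) -/

section Thm1C
variable (ε₀ ε₂₉ B₃ a₀ a₁ : ℝ) (lam : ResidW F N) (σ : ∀ P : B12.RunParams, Sit189 F N P.K)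
  (s : ∀ P : B12.RunParams, SeqOfRecord F (theta13OfThm1C F N ε₀ ε₂₉ B₃ a₀ a₁).ν (theta13OfThm1C F N ε₀ ε₂₉ B₃ a₀ a₁).τ9.M
    (gOfRecord₁₃ F N (theta13OfThm1C F N ε₀ ε₂₉ B₃ a₀ a₁) P) P.K (lam.kSel P + 1)) (Nm : B12.RunParams → ℕ) (p₁ : ℕ)

/-- **NON-VACUITY AT `θ₁₅ᶜ` FOR THE `Λ`-PINNED LAYER, ADMISSIBILITY FROM THE FIVE WITNESS SIGNS** (14C's `new189_pinAllTH_liveRepin₁₃_one_zero` at the `Λ`-pinned family, K0a's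
`admissible_theta13OfThm1C`): on a run whose ₁₃ history lies in `]0, ½]` up to `n ≥ kSel P + 1`, with residual numbers `0 ≤ β < 1`, `0 < L₀`, `0 ≤ O(1)B₃B₅`, the (1.80) ∕ (1.89) antecedent
`new189 (λᴧ.D189 P) (1, 0)` HOLDS — §2's displays are not vacuous there. [cite: Balaban1989LargeFieldI, (1.82) p.196, (1.89) p.198; Balaban1988Convergent, (2.4) p.255, (2.10) p.256 (bookkeeping census)] -/
theorem new189_pinAllTHΛ_theta13OfThm1C_one_zero (hε : 0 < ε₀) (hε' : 0 < ε₂₉) (hB : 0 ≤ B₃) (ha₀ : 0 < a₀) (ha₁ : 0 < a₁)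
    (P : B12.RunParams) {n : ℕ} (hI : Step.InInterval (theta13OfThm1C F N ε₀ ε₂₉ B₃ a₀ a₁).γ n (gOfRecord₁₃ F N (theta13OfThm1C F N ε₀ ε₂₉ B₃ a₀ a₁) P))
    (hkn : lam.kSel P + 1 ≤ n) (hβ0 : 0 ≤ (σ P).β) (hβ1 : (σ P).β < 1) (hL₀ : 0 < (σ P).L₀) (hBB : 0 ≤ (σ P).O1 * (σ P).B₃ * (σ P).B₅) :
    new189 (((lam.pinRPrime₁₃ (theta13OfThm1C F N ε₀ ε₂₉ B₃ a₀ a₁)).pinD189ΛH (theta13OfThm1C F N ε₀ ε₂₉ B₃ a₀ a₁).ν (theta13OfThm1C F N ε₀ ε₂₉ B₃ a₀ a₁).A₁ (theta13OfThm1C F N ε₀ ε₂₉ B₃ a₀ a₁).τ9.M (gOfRecord₁₃ F N (theta13OfThm1C F N ε₀ ε₂₉ B₃ a₀ a₁)) σ s Nm p₁).D189 P)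
      ((1 : MSField (F.P P.K) (SU N)), fun _ _ => (0 : EuclideanSpace ℝ (Fin (N ^ 2 - 1)))) :=
  new189_pinAllTH_liveRepin₁₃_one_zero
    (theta13OfNumerics F N (stage12NumericsOfThm1C F.L ε₀ B₃ a₀ a₁) ε₂₉ (zeta316OfRecord F N (stage12NumericsOfThm1C F.L ε₀ B₃ a₀ a₁).ν (stage12NumericsOfThm1C F.L ε₀ B₃ a₀ a₁).τ9.M (stage12NumericsOfThm1C F.L ε₀ B₃ a₀ a₁).A₁) (RzOfRecord F N) (ZtOfRecord F N))
    lam (fun P => ((((σ P).pinLambda (s P) (N0OfRecord₁₃ (theta13OfThm1C F N ε₀ ε₂₉ B₃ a₀ a₁) P (lam.kSel P + 1)) (enlD F (theta13OfThm1C F N ε₀ ε₂₉ B₃ a₀ a₁).ν (theta13OfThm1C F N ε₀ ε₂₉ B₃ a₀ a₁).τ9.M P (gOfRecord₁₃ F N (theta13OfThm1C F N ε₀ ε₂₉ B₃ a₀ a₁) P))).pinDistAt (lam.kSel P + 1)).pinZpp (s P) (N0OfRecord₁₃ (theta13OfThm1C F N ε₀ ε₂₉ B₃ a₀ a₁) P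 (lam.kSel P + 1)) (Nm P) (enlD F (theta13OfThm1C F N ε₀ ε₂₉ B₃ a₀ a₁).ν (theta13OfThm1C F N ε₀ ε₂₉ B₃ a₀ a₁).τ9.M P (gOfRecord₁₃ F N (theta13OfThm1C F N ε₀ ε₂₉ B₃ a₀ a₁) P))).pinCubes
      (((((σ P).pinLambda (s P) (N0OfRecord₁₃ (theta13OfThm1C F N ε₀ ε₂₉ B₃ a₀ a₁) P (lam.kSel P + 1)) (enlD F (theta13OfThm1C F N ε₀ ε₂₉ B₃ a₀ a₁).ν (theta13OfThm1C F N ε₀ ε₂₉ B₃ a₀ a₁).τ9.M P (gOfRecord₁₃ F N (theta13OfThm1C F N ε₀ ε₂₉ B₃ a₀ a₁) P))).pinDistAt (lam.kSel P + 1)).pinZpp (s P) (N0OfRecord₁₃ (theta13OfThm1C F N ε₀ ε₂₉ B₃ a₀ a₁) P (lam.kSel P + 1)) (Nm P) (enlD F (theta13OfThm1C F N ε₀ ε₂₉ B₃ a₀ a₁).ν (theta13OfThm1C F N ε₀ ε₂₉ B₃ a₀ a₁).τ9.M P (gOfRecord₁₃ F N (theta13OfThm1C F N ε₀ ε₂₉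 B₃ a₀ a₁) P))).OmTᶜ ∩ omegaOfChain (s P) (lam.kSel P + 1 - Nm P))) s Nm (fun P => N0OfRecord₁₃ (theta13OfThm1C F N ε₀ ε₂₉ B₃ a₀ a₁) P (lam.kSel P + 1)) p₁
    (admissible_theta13OfThm1C F N hε hε' hB ha₀ ha₁) P hI hkn hβ0 hβ1 hL₀ hBB

/-- **★★★ N12's MOST-PINNED ROW OF RECORD AT `θ₁₅ᶜ`: the `Λ`-, cube-, distance-, `Z″`- and `N₀`-pinned term-pinned bundle `WOfRecord₁₃ θ₁₅ᶜ λᴧ P`, `kSel P < K` — ZERO K0-SIDE HYPOTHESES, NO (1.89)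
DISPLAY, NO LOCATED-GEOMETRY BINDER** (§1 at `Θ := theta13OfNumerics … (stage12NumericsOfThm1C …) …`, whose ₁₃ live re-pin IS `θ₁₅ᶜ`).  THE KERNEL's LIST OF WHAT N12 COSTS PER RUN AT THE PLAN's
WITNESS = this hypothesis list (see the header): live-mass at level `kSel P + 1`; Prop. 1 at `λ.LF P`; the levels; the situation's residual numbers and print's two p. 200 conditions; the flow
inputs; the coupling step; `Λ ≠ ∅`; the four ℍ-leaves and (1.80) — `0 < M` is DISCHARGED here (`M` of record at `θ₁₅ᶜ` is `1`, `rfl`; print's «M large» survives only as the residual `hMl`). [cite: Balaban1989LargeFieldI, (0.2)–(0.6) p.176, p.176 ll.14–16, (1.73) p.192, Prop. 1 (1.78) p.194, (1.80) p.195, (1.10)–(1.11) p.179, (1.88)–(1.90) pp.197–198, pp.199–201; Balaban1988Convergent, (2.1) p.254, (2.5)–(2.8) pp.255–256, (2.17) p.257, (3.16) p.268, (3.22)–(3.25) pp.269–270; Balaban1987RG1, (0.20) p.256; Balaban1985Variational, Thm 1 p.279 (witness letters only)] -/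
theorem b15Leaf_WOfRecord₁₃_pinAllΛ_N0_theta13OfThm1C_of_massLive_of_flow
    {P : B12.RunParams} (hK : lam.kSel P < P.K) (hsh : 0 < (σ P).sh)
    {D : Setting189 (F.P P.K) (SU N) (MSField (F.P P.K) (SU N) × ((j : ℕ) → VecField (F.P P.K) j (EuclideanSpace ℝ (Fin (N ^ 2 - 1))))) (Pt (F.P P.K).d)}
    (hD : D = ((lam.pinRPrime₁₃ (theta13OfThm1C F N ε₀ ε₂₉ B₃ a₀ a₁)).pinD189ΛH (theta13OfThm1C F N ε₀ ε₂₉ B₃ a₀ a₁).ν (theta13OfThm1C F N ε₀ ε₂₉ B₃ a₀ a₁).A₁ (theta13OfThm1C F N ε₀ ε₂₉ B₃ a₀ a₁).τ9.M (gOfRecord₁₃ F N (theta13OfThm1C F N ε₀ ε₂₉ B₃ a₀ a₁)) σ s Nm p₁).D189 P)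
    (hmassLive : ∀ a, LiveSeq F N (theta13OfThm1C F N ε₀ ε₂₉ B₃ a₀ a₁).ν (theta13OfThm1C F N ε₀ ε₂₉ B₃ a₀ a₁).τ9 P (gOfRecord₁₃ F N (theta13OfThm1C F N ε₀ ε₂₉ B₃ a₀ a₁) P) (lam.kSel P + 1)
        (slotsTOfRecord F N (theta13OfThm1C F N ε₀ ε₂₉ B₃ a₀ a₁).ν (theta13OfThm1C F N ε₀ ε₂₉ B₃ a₀ a₁).τ9 (EOfRecord₁₃ F N (theta13OfThm1C F N ε₀ ε₂₉ B₃ a₀ a₁)) (wOfRecord₉ F N (theta13OfThm1C F N ε₀ ε₂₉ B₃ a₀ a₁).toStage9Params)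
          (theta13OfThm1C F N ε₀ ε₂₉ B₃ a₀ a₁).ppSel P (gOfRecord₁₃ F N (theta13OfThm1C F N ε₀ ε₂₉ B₃ a₀ a₁) P) (lam.kSel P + 1)) a →
      0 < ∫ V, rterm (reprTOfRecord₁₃ F N (theta13OfThm1C F N ε₀ ε₂₉ B₃ a₀ a₁) P (lam.kSel P)) a V ∂(fieldMeasure (F.P P.K) (lam.kSel P + 1) (SU N)))
    (hP1 : Prop1Printed (lam.LF P))
    (hlog : 1 < (Real.log (gOfRecord₁₃ F N (theta13OfThm1C F N ε₀ ε₂₉ B₃ a₀ a₁) P (lam.kSel P + 1) ^ 2)⁻¹) ^ (theta13OfThm1C F N ε₀ ε₂₉ B₃ a₀ a₁).ν.r)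
    (hNN : N0OfRecord₁₃ (theta13OfThm1C F N ε₀ ε₂₉ B₃ a₀ a₁) P (lam.kSel P + 1) ≤ Nm P) (hNk : N0OfRecord₁₃ (theta13OfThm1C F N ε₀ ε₂₉ B₃ a₀ a₁) P (lam.kSel P + 1) ≤ lam.kSel P + 1)
    (hβ0 : 0 ≤ (σ P).β) (hβ : (σ P).β ≤ 1 / 4) (hL₀ : 2 ≤ (σ P).L₀) (hL₀L : (σ P).L₀ ^ 2 ≤ ((F.P P.K).L : ℝ))
    (hB : 0 ≤ (σ P).O1 * (σ P).B₃ * (σ P).B₅) (hδ : 0 ≤ (σ P).δ)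
    (hN₀ : (2 + (121 / 120) ^ 2 * ((σ P).O1 * (σ P).B₃ * (σ P).B₅ * ((theta13OfThm1C F N ε₀ ε₂₉ B₃ a₀ a₁).τ9.M : ℝ) ^ 5)) *
      ((((σ P).L₀ ^ 2) ^ (N0OfRecord₁₃ (theta13OfThm1C F N ε₀ ε₂₉ B₃ a₀ a₁) P (lam.kSel P + 1) - 1))⁻¹) ≤ 1 / 4)
    (hMl : (121 / 120) ^ 2 * ((σ P).O1 * (σ P).B₃ * (σ P).B₅ * ((theta13OfThm1C F N ε₀ ε₂₉ B₃ a₀ a₁).τ9.M : ℝ) ^ 5) * Real.exp (-(4 * (σ P).δ * ((theta13OfThm1C F N ε₀ ε₂₉ B₃ a₀ a₁).τ9.M : ℝ))) ≤ 1 / 12)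
    (hε0 : ∀ i, lam.kSel P + 1 - Nm P ≤ i → i ≤ lam.kSel P + 1 → 0 ≤ epsOfRecord (theta13OfThm1C F N ε₀ ε₂₉ B₃ a₀ a₁).ν (gOfRecord₁₃ F N (theta13OfThm1C F N ε₀ ε₂₉ B₃ a₀ a₁) P) i)
    (hε1 : ∀ i, lam.kSel P + 1 - Nm P ≤ i → i ≤ lam.kSel P + 1 → epsOfRecord (theta13OfThm1C F N ε₀ ε₂₉ B₃ a₀ a₁).ν (gOfRecord₁₃ F N (theta13OfThm1C F N ε₀ ε₂₉ B₃ a₀ a₁) P) i ≤ 1 / 10)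
    {β₀ : ℝ} (hβ₀0 : 0 ≤ β₀) (hβ₀ : β₀ ≤ 1 / 2)
    (hflow : ∀ j, lam.kSel P + 1 - Nm P ≤ j → j < lam.kSel P + 1 → epsOfRecord (theta13OfThm1C F N ε₀ ε₂₉ B₃ a₀ a₁).ν (gOfRecord₁₃ F N (theta13OfThm1C F N ε₀ ε₂₉ B₃ a₀ a₁) P) (lam.kSel P + 1)
      ≤ (1 + β₀) * Real.sqrt ((lam.kSel P + 1 - j : ℕ) : ℝ) * epsOfRecord (theta13OfThm1C F N ε₀ ε₂₉ B₃ a₀ a₁).ν (gOfRecord₁₃ F N (theta13OfThm1C F N ε₀ ε₂₉ B₃ a₀ a₁) P) j)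
    -- the `N₀`-equation's one step of monotone couplings, and `Λ ≠ ∅` (a non-trivial 𝐑-step)
    (hgpos : 0 < (gOfRecord₁₃ F N (theta13OfThm1C F N ε₀ ε₂₉ B₃ a₀ a₁) P) (lam.kSel P + 1 + 1 - (N0OfRecord₁₃ (theta13OfThm1C F N ε₀ ε₂₉ B₃ a₀ a₁) P (lam.kSel P + 1))))
    (hgstep : (gOfRecord₁₃ F N (theta13OfThm1C F N ε₀ ε₂₉ B₃ a₀ a₁) P) (lam.kSel P + 1 + 1 - (N0OfRecord₁₃ (theta13OfThm1C F N ε₀ ε₂₉ B₃ a₀ a₁) P (lam.kSel P + 1))) ≤ (gOfRecord₁₃ F N (theta13OfThm1C F N ε₀ ε₂₉ B₃ a₀ a₁) P) (lam.kSel P + 1 + 2 - (N0OfRecord₁₃ (theta13OfThm1C F N ε₀ ε₂₉ B₃ a₀ a₁) P (lam.kSel P + 1))))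
    (hgle : (gOfRecord₁₃ F N (theta13OfThm1C F N ε₀ ε₂₉ B₃ a₀ a₁) P) (lam.kSel P + 1 + 2 - (N0OfRecord₁₃ (theta13OfThm1C F N ε₀ ε₂₉ B₃ a₀ a₁) P (lam.kSel P + 1))) ≤ 1)
    (hΛ : (((enlD F (theta13OfThm1C F N ε₀ ε₂₉ B₃ a₀ a₁).ν (theta13OfThm1C F N ε₀ ε₂₉ B₃ a₀ a₁).τ9.M P (gOfRecord₁₃ F N (theta13OfThm1C F N ε₀ ε₂₉ B₃ a₀ a₁) P)) 4 (lam.kSel P + 1 + 1 - (N0OfRecord₁₃ (theta13OfThm1C F N ε₀ ε₂₉ B₃ a₀ a₁) P (lam.kSel P + 1)))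
        (omegaOfChain (s P) (lam.kSel P + 1 + 1 - (N0OfRecord₁₃ (theta13OfThm1C F N ε₀ ε₂₉ B₃ a₀ a₁) P (lam.kSel P + 1)))))ᶜ ∩ (σ P).Z).Nonempty)
    (L91h : ∀ U, new189 D U → ∀ p ∈ plaqsOf (half D),
      Ineq191 (dist1 (plaqHol (D.Upp U) p)) (D.devV'' U p) D.α ((D.L ^ D.h)⁻¹) (D.ε D.h) (E124 D.ε D.L D.η D.k D.h))
    (L95 : ∀ U, new189 D U → ∀ p ∈ plaqsOf (half D),
      Ineq195 (D.devV'' U p) (dist1 (plaqHol (D.Uhalf U (D.boxOf p)) p)) D.α ((D.L ^ D.h)⁻¹) (D.ε D.h) (E124 D.ε D.L D.η D.k D.h))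
    (L91 : ∀ U, new189 D U → ∀ j, D.h ≤ j → j ≤ D.k → ∀ p ∈ plaqsOf (dom D j),
      Ineq191 (dist1 (plaqHol (D.Upp U) p)) (D.dev97 U p) D.α ((D.L ^ j)⁻¹) (D.ε j) (E124 D.ε D.L D.η D.k j))
    (L97 : ∀ U, new189 D U → ∀ j, D.h ≤ j → j ≤ D.k → ∀ p ∈ plaqsOf (dom D j),
      Ineq191 (D.dev97 U p) (D.dev0 U p) D.α ((D.L ^ j)⁻¹) (D.ε j) (E124 D.ε D.L D.η D.k j))
    (L80 : ∀ U, new189 D U → ∀ j, D.h ≤ j → j ≤ D.k → ∀ p ∈ plaqsOf (dom D j),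
      Ineq180 (D.dev0 U p) (D.ε D.k) D.η D.B₃ D.B₅ D.M D.δ (D.dist p) D.O1) :
    B15Leaf (WOfRecord₁₃ F N (theta13OfThm1C F N ε₀ ε₂₉ B₃ a₀ a₁)
      ((lam.pinRPrime₁₃ (theta13OfThm1C F N ε₀ ε₂₉ B₃ a₀ a₁)).pinD189ΛH (theta13OfThm1C F N ε₀ ε₂₉ B₃ a₀ a₁).ν (theta13OfThm1C F N ε₀ ε₂₉ B₃ a₀ a₁).A₁ (theta13OfThm1C F N ε₀ ε₂₉ B₃ a₀ a₁).τ9.M (gOfRecord₁₃ F N (theta13OfThm1C F N ε₀ ε₂₉ B₃ a₀ a₁)) σ s Nm p₁) P) :=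
  b15Leaf_WOfRecord₁₃_pinAllΛ_N0_liveRepin₁₃_of_massLive_of_hasResiduals_of_flow
    (theta13OfNumerics F N (stage12NumericsOfThm1C F.L ε₀ B₃ a₀ a₁) ε₂₉ (zeta316OfRecord F N (stage12NumericsOfThm1C F.L ε₀ B₃ a₀ a₁).ν (stage12NumericsOfThm1C F.L ε₀ B₃ a₀ a₁).τ9.M (stage12NumericsOfThm1C F.L ε₀ B₃ a₀ a₁).A₁) (RzOfRecord F N) (ZtOfRecord F N)) lam σ s Nm p₁
    (hasResidualsOfRecord_theta13OfNumerics F N (stage12NumericsOfThm1C F.L ε₀ B₃ a₀ a₁) ε₂₉) hK hsh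
    Nat.one_pos -- `M` of record at `θ₁₅ᶜ` is `1` (`rfl`): print's «M large» survives only as the residual `hMl`
    hD hmassLive hP1 hlog hNN hNk hβ0 hβ hL₀ hL₀L hB hδ hN₀ hMl hε0 hε1 hβ₀0 hβ₀ hflow
    hgpos hgstep hgle hΛ L91h L95 L91 L97 L80


end Thm1C

end Summit.QuantumFields.YangMills.BalabanUVNodes.N12AtRecord13TermPinnedLambda
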